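import Mathlib.NumberTheory.Padics.PadicNumbers
import Mathlib.RingTheory.Adjoin.Basic
import Mathlib.Algebra.Order.AbsoluteValue.Basic
import HarnessLib

/-!
# Joshi's log-shells II ([J-III] arXiv:2401.13508 v4, §9.3): the Banach space `(1/t)·B^{φ=p}` as the log-shell for `B[1/t]`
# (Thm. 9.3.1.1, Def. 9.3.2.1, Lemma 9.3.2.3) — TYPED, no side taken

Record file of the abc-iut cell, branch E (rung LADDER-ABC:A2.E; seat abc-iut-E-t19, slot T-19; sequel of `Joshi/LogShellsJoshi.lean`,
§9.1–§9.2). Source: K. Joshi, *Construction of Arithmetic Teichmuller Spaces III*, «Preliminary version for comments»,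
arXiv:2401.13508 v4 = bib `Joshi2024ATS3`; «p. N l. a–b» = PDF page N, lines of the render `HOME/lit/renders/Joshi-arxiv-2401.13508/`.
UNREFEREED preprint, rejected by the IUT author [Mochizuki2024JoshiReport]; TYPED AS A CANDIDATE (D-0012): typed ≠ proved ≠
endorsed; nothing here asserts abc, [IUTchIII] Cor. 3.12, or any claim of [J-III]. The [FarguesFontaine2018] facts Joshi recalls
(Thm. 9.3.1.1) are FIELDS of the signature `PeriodRingBt` (cell rule: no new `Prop` facts); his assertions are `def … : Prop`
with `@[claim "Joshi2024ATS3" "disputed"]`; what follows from the signature is PROVED.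

* Thm. 9.3.1.1 (p. 98 l. 25–34; [FarguesFontaine2018, Prop. 4.4.6, Thm. 6.2.1]): «(1) an isomorphism of `ℚ_p`-Banach spaces
  `Ĝ_m(𝒪_{ℂ_p^♭}) = 1 + 𝔪_{ℂ_p^♭} ≃ B^{φ=p}` given by `1 + x ↦ log([1 + x])`. (2) The ring `B` is generated as a `ℚ_p`-algebra
  by `B^{φ=p}`» — FIELDS `logTeich`, `logTeich_mul`, `bijOn_logTeich`, `adjoin_Bphi` (the Banach topology is NOT typed).
* §9.3.2 (p. 98 l. 35–37): «`B^{φ=p}` is the analog of Mochizuki's log-shell» — dictionary hint (docstring).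
* Def. 9.3.2.1 (p. 99 l. 1–4): `I_{joshi,p} := (1/t)·B^{φ=p}`, «the log-shell for `B[1/t]`» — `joshiLogShell`; `B_e = B[1/t]^{φ=1}`
  (§5.2.6, recalled p. 99 l. 5–7) — `Be` (MERGE-DEBT: E-t9, J3 Def. 5.2.6, `Joshi/LocalPeriodRings.lean`; E-t3's `PeriodRingDatum`
  (J2p §2) owns `B`, `[−]`, `φ|_B`: reconcile by import when they land); «generated by `(1/t)·B^{φ=p}`» — claim
  `BeGeneratedByLogShell`.
* Lemma 9.3.2.3 (p. 99 l. 9–43): (1) `I_{joshi,p} = log(1 + 𝔪_{ℂ_p^♭})/t` DERIVED (`joshiLogShell_eq_image_logTeich`); (2) «for all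
  `n ∈ ℤ`, `φⁿ(I_{joshi,p}) ⊂ I_{joshi,p}`» DERIVED exactly as printed ((9.3.2.4): `φ(b/t) = φ(b)/φ(t) = pb/pt = b/t`;
  `frob_eq_self_of_mem_joshiLogShell`, `image_frob_zpow_subset`) together with `I_{joshi,p} ⊂ B_e`; (3) second equality
  `= B_e^{deg ≤ 1}` ((9.3.2.5), `X = Proj(B_e)`) and (4) («functions on `X_{ℂ_p^♭,ℚ_p}` of degree `≤ 1` invariant under
  Frobenius») NOT typed: the degree filtration of `B_e` is absent (merge-debt E-t9).
* Rmk. 9.3.2.6 (p. 99 l. 44 – p. 100 l. 2): the `φ`-stability (2) «corresponds to the stability of Mochizuki's log-shells under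
  iterates of Mochizuki's log-links» [IUTchIII, Rmk. 1.1.1, 1.2.2 (iii)] — in OUR typing the (Ind3) containments of
  `Thm311LogKummer` (dictionary hint; no object).

Design: `φ` is a `ℚ_p`-algebra AUTOMORPHISM of `B[1/t]` (so that `n ∈ ℤ` makes sense), preserving the subalgebra `B`, with
`φ(t) = p·t` (p. 99 l. 28–32; OUR nearest typed fact: `Literature.NumberTheory.PAdicHodge.frobBmaxPlus_tBmax`, `φ(t) = p·t` in
`B_max⁺`, with `tBmax`, `tBdR` — the Fargues–Fontaine ring `B` itself is INTERFACE-class, absent from Mathlib and the tree).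
NOT here: the Fargues–Fontaine curve, norms `|−|_ρ`, `B⁺`, `B_dR`, any judgement.
[claim: Joshi2024ATS3, status: disputed]
-/

set_option autoImplicit false

noncomputable section

open Set

namespace Summit.ABC.IUTFork.Joshi

variable (p : ℕ) [Fact p.Prime] (F Bt : Type) [Field F] [CommRing Bt] [Algebra ℚ_[p] Bt]

/-- **SIGNATURE `PeriodRingBt`** — what §9.3 uses of the Fargues–Fontaine rings (J3 §5.2; MERGE-DEBT E-t3 / E-t9): the tilt
`F = ℂ_p^♭` with `|−|_F` (for `1 + 𝔪_F = {|u − 1| < 1}`); the `ℚ_p`-algebra `B[1/t]` (`Bt`) with the subalgebra `B = B_{ℂ_p^♭, ℚ_p}`,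
the unit `t` (`t ∈ B`), the Frobenius `φ`, a `ℚ_p`-algebra automorphism of `B[1/t]` preserving `B` with `φ(t) = p·t` ((9.3.2.4),
p. 99 l. 28–32); and Thm. 9.3.1.1 (p. 98 l. 25–34, [FarguesFontaine2018, Prop. 4.4.6, Thm. 6.2.1]) as FIELDS: `u ↦ log([u])` on
`1 + 𝔪_F` is a homomorphism and a bijection onto `B^{φ=p}` («`1 + 𝔪_{ℂ_p^♭} ≃ B^{φ=p}` given by `1 + x ↦ log([1 + x])`»; Banach
topology not typed), and «`B` is generated as a `ℚ_p`-algebra by `B^{φ=p}`». HYPOTHESIS structure; nothing asserted; never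
instantiated here. [claim: Joshi2024ATS3, status: disputed] -/
structure PeriodRingBt where
  /-- `|−|_F` on the tilt `F = ℂ_p^♭` -/
  absF : AbsoluteValue F ℝ
  /-- the subalgebra `B = B_{ℂ_p^♭, ℚ_p} ⊂ B[1/t]` (§5.2.1) -/
  B : Subalgebra ℚ_[p] Bt
  /-- `t`, a unit of `B[1/t]` -/
  t : Btˣ
  /-- `t ∈ B` -/
  t_mem : (t : Bt) ∈ B
  /-- the Frobenius `φ` of `B[1/t]` -/
  frob : Bt ≃ₐ[ℚ_[p]] Bt
  /-- `φ(B) ⊆ B` -/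
  frob_mem : ∀ b ∈ B, frob b ∈ B
  /-- `φ(t) = p·t` ((9.3.2.4), p. 99 l. 28–32; cf. `Literature.NumberTheory.PAdicHodge.frobBmaxPlus_tBmax`) -/
  frob_t : frob t = (p : ℚ_[p]) • (t : Bt)
  /-- `u ↦ log([u])` for `u ∈ 1 + 𝔪_F` (Thm. 9.3.1.1 (1); total on `F`, meaningful on `1 + 𝔪_F`) -/
  logTeich : F → Bt
  /-- `log([uu′]) = log([u]) + log([u′])` on `1 + 𝔪_F` (Thm. 9.3.1.1 (1) is an isomorphism of groups) -/
  logTeich_mul : ∀ u u' : F, absF (u - 1) < 1 → absF (u' - 1) < 1 → logTeich (u * u') = logTeich u + logTeich u'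
  /-- Thm. 9.3.1.1 (1) [FarguesFontaine2018, Prop. 4.4.6]: `1 + 𝔪_F → B^{φ=p}`, `u ↦ log([u])`, is a bijection -/
  bijOn_logTeich : Set.BijOn logTeich {u | absF (u - 1) < 1} {b | b ∈ B ∧ frob b = (p : ℚ_[p]) • b}
  /-- Thm. 9.3.1.1 (2) [FarguesFontaine2018, Thm. 6.2.1]: `B` is generated as a `ℚ_p`-algebra by `B^{φ=p}` -/
  adjoin_Bphi : Algebra.adjoin ℚ_[p] {b | b ∈ B ∧ frob b = (p : ℚ_[p]) • b} = B

namespace PeriodRingBt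

variable {p F Bt} (D : PeriodRingBt p F Bt)

/-- `1 + 𝔪_F = Ĝ_m(𝒪_{ℂ_p^♭})` as the set `{u ∈ F : |u − 1|_F < 1}` (Thm. 9.3.1.1 (1), p. 98 l. 27–29). [claim: Joshi2024ATS3, status: disputed] -/
def principalUnits : Set F := {u | D.absF (u - 1) < 1}

/-- **`B^{φ=p}`** (§9.3.1, p. 98 l. 24–32): the `ℚ_p`-subspace of `B` on which `φ` acts by `p` (a submodule: PROVED).
[claim: Joshi2024ATS3, status: disputed] -/
def Bphi : Submodule ℚ_[p] Bt where
  carrier := {b | b ∈ D.B ∧ D.frob b = (p : ℚ_[p]) • b}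
  zero_mem' := ⟨D.B.zero_mem, by simp⟩
  add_mem' := by
    rintro a b ⟨ha, ha'⟩ ⟨hb, hb'⟩
    exact ⟨D.B.add_mem ha hb, by rw [map_add, ha', hb', smul_add]⟩
  smul_mem' := by
    rintro c b ⟨hb, hb'⟩
    exact ⟨D.B.smul_mem hb c, by rw [map_smul, hb', smul_comm]⟩

/-- Membership in `B^{φ=p}`. [claim: Joshi2024ATS3, status: disputed] -/
theorem mem_Bphi_iff (b : Bt) : b ∈ D.Bphi ↔ b ∈ D.B ∧ D.frob b = (p : ℚ_[p]) • b := Iff.rfl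

/-- Thm. 9.3.1.1 (1) rephrased: `log([−])` maps `1 + 𝔪_F` bijectively onto `B^{φ=p}`. [claim: Joshi2024ATS3, status: disputed] -/
theorem bijOn_logTeich_Bphi : Set.BijOn D.logTeich D.principalUnits (D.Bphi : Set Bt) := D.bijOn_logTeich

/-- **Def. 9.3.2.1** (p. 99 l. 1–4): «`I_{joshi,p} = (1/t)·B^{φ=p}` … the log-shell for `B[1/t]`» — the image of `B^{φ=p}` under
multiplication by `t⁻¹`. («`B^{φ=p}` is the analog of Mochizuki's log-shell», §9.3.2 p. 98 l. 35–37.) [claim: Joshi2024ATS3, status: disputed] -/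
def joshiLogShell : Submodule ℚ_[p] Bt := D.Bphi.map (LinearMap.mulLeft ℚ_[p] ((D.t⁻¹ : Btˣ) : Bt))

/-- Membership in `I_{joshi,p}`: `x = t⁻¹·b` with `b ∈ B^{φ=p}`. [claim: Joshi2024ATS3, status: disputed] -/
theorem mem_joshiLogShell_iff (x : Bt) : x ∈ D.joshiLogShell ↔ ∃ b ∈ D.Bphi, ((D.t⁻¹ : Btˣ) : Bt) * b = x := by
  simp [joshiLogShell, Submodule.mem_map]

/-- **`B_e := B[1/t]^{φ=1}`** (§5.2.6, recalled p. 99 l. 5–7): «the `ℚ_p`-algebra of Frobenius-invariant elements of `B[1/t]`» —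
the fixed subalgebra of `φ` (PROVED to be a subalgebra). MERGE-DEBT E-t9 (J3 Def. 5.2.6). [claim: Joshi2024ATS3, status: disputed] -/
def Be : Subalgebra ℚ_[p] Bt where
  carrier := {x | D.frob x = x}
  mul_mem' := fun {a b} ha hb => by
    simp only [Set.mem_setOf_eq] at ha hb ⊢; rw [map_mul, ha, hb]
  one_mem' := map_one D.frob
  add_mem' := fun {a b} ha hb => by
    simp only [Set.mem_setOf_eq] at ha hb ⊢; rw [map_add, ha, hb]
  zero_mem' := map_zero D.frob
  algebraMap_mem' := fun c => D.frob.commutes c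

/-- Membership in `B_e`. [claim: Joshi2024ATS3, status: disputed] -/
theorem mem_Be_iff (x : Bt) : x ∈ D.Be ↔ D.frob x = x := Iff.rfl

/-- «`B_e` … (generated by `(1/t)·B^{φ=p}`)» (p. 99 l. 6–7), as a `ℚ_p`-algebra. HYPOTHESIS ([FarguesFontaine2018]).
[claim: Joshi2024ATS3, status: disputed] -/
@[claim "Joshi2024ATS3" "disputed"]
def BeGeneratedByLogShell : Prop := Algebra.adjoin ℚ_[p] (D.joshiLogShell : Set Bt) = D.Be

/-- `φ(t⁻¹) = p⁻¹·t⁻¹` (from `φ(t) = p·t`). [claim: Joshi2024ATS3, status: disputed] -/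
theorem frob_t_inv : D.frob ((D.t⁻¹ : Btˣ) : Bt) = (p : ℚ_[p])⁻¹ • ((D.t⁻¹ : Btˣ) : Bt) := by
  have hp : (p : ℚ_[p]) ≠ 0 := by exact_mod_cast (Fact.out : p.Prime).ne_zero
  have h1 : D.frob ((D.t⁻¹ : Btˣ) : Bt) * D.frob (D.t : Bt) = 1 := by
    rw [← map_mul, Units.inv_mul, map_one]
  rw [D.frob_t, mul_smul_comm] at h1
  have h2 : D.frob ((D.t⁻¹ : Btˣ) : Bt) * (D.t : Bt) = (p : ℚ_[p])⁻¹ • (1 : Bt) := by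
    rw [← h1, smul_smul, inv_mul_cancel₀ hp, one_smul]
  calc D.frob ((D.t⁻¹ : Btˣ) : Bt)
      = D.frob ((D.t⁻¹ : Btˣ) : Bt) * (D.t : Bt) * ((D.t⁻¹ : Btˣ) : Bt) := by rw [mul_assoc, Units.mul_inv, mul_one]
    _ = (p : ℚ_[p])⁻¹ • ((D.t⁻¹ : Btˣ) : Bt) := by rw [h2, smul_mul_assoc, one_mul]

/-- **Lemma 9.3.2.3 (2), the printed computation (9.3.2.4)** (p. 99 l. 25–34): for `b ∈ B^{φ=p}`,
`φ(b/t) = φ(b)/φ(t) = p·b/(p·t) = b/t`, «so `b/t` is a `φ` invariant or Frobenius fixed element». DERIVED.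
[claim: Joshi2024ATS3, status: disputed] -/
theorem frob_eq_self_of_mem_joshiLogShell {x : Bt} (hx : x ∈ D.joshiLogShell) : D.frob x = x := by
  obtain ⟨b, hb, rfl⟩ := (D.mem_joshiLogShell_iff x).1 hx
  have hp : (p : ℚ_[p]) ≠ 0 := by exact_mod_cast (Fact.out : p.Prime).ne_zero
  rw [map_mul, D.frob_t_inv, hb.2, smul_mul_smul_comm, inv_mul_cancel₀ hp, one_smul]

/-- DERIVED: `I_{joshi,p} = (1/t)·B^{φ=p} ⊂ B_e = B[1/t]^{φ=1}` (Lemma 9.3.2.3 (3), first part, p. 99 l. 16–19).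
[claim: Joshi2024ATS3, status: disputed] -/
theorem joshiLogShell_subset_Be : (D.joshiLogShell : Set Bt) ⊆ D.Be := fun _ hx => D.frob_eq_self_of_mem_joshiLogShell hx

/-- A `φ`-fixed element is fixed by every integer power `φⁿ`, `n ∈ ℤ`. [folklore] -/
theorem frob_zpow_apply_of_fixed {x : Bt} (hx : D.frob x = x) (n : ℤ) : (D.frob ^ n) x = x := by
  have hs : D.frob.symm x = x := by
    conv_lhs => rw [← hx]
    exact D.frob.symm_apply_apply x
  induction n using Int.induction_on with
  | zero => simp
  | succ n ih => rw [zpow_add_one, AlgEquiv.mul_apply, hx, ih]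
  | pred n ih => rw [zpow_sub_one, AlgEquiv.mul_apply, AlgEquiv.aut_inv, hs, ih]

/-- **Lemma 9.3.2.3 (2)** (p. 99 l. 14–15): «For all `n ∈ ℤ` one has `φⁿ(I_{joshi,p}) ⊂ I_{joshi,p}`» (indeed `φⁿ` fixes
`I_{joshi,p}` pointwise). DERIVED. [claim: Joshi2024ATS3, status: disputed] -/
theorem frob_zpow_mem_joshiLogShell (n : ℤ) {x : Bt} (hx : x ∈ D.joshiLogShell) : (D.frob ^ n) x ∈ D.joshiLogShell := by
  rw [D.frob_zpow_apply_of_fixed (D.frob_eq_self_of_mem_joshiLogShell hx) n]; exact hx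

/-- Lemma 9.3.2.3 (2) as the image inclusion `φⁿ(I_{joshi,p}) ⊆ I_{joshi,p}`, `n ∈ ℤ`. [claim: Joshi2024ATS3, status: disputed] -/
theorem image_frob_zpow_subset (n : ℤ) : (D.frob ^ n) '' (D.joshiLogShell : Set Bt) ⊆ D.joshiLogShell := by
  rintro _ ⟨x, hx, rfl⟩; exact D.frob_zpow_mem_joshiLogShell n hx

/-- **Lemma 9.3.2.3 (1)** (p. 99 l. 10–13): «`I_{joshi,p} = log(1 + 𝔪_{ℂ_p^♭})/t`» — DERIVED from Thm. 9.3.1.1 (1).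
[claim: Joshi2024ATS3, status: disputed] -/
theorem joshiLogShell_eq_image_logTeich :
    (D.joshiLogShell : Set Bt) = (fun u => ((D.t⁻¹ : Btˣ) : Bt) * D.logTeich u) '' D.principalUnits := by
  ext x
  rw [SetLike.mem_coe, D.mem_joshiLogShell_iff]
  constructor
  · rintro ⟨b, hb, rfl⟩
    obtain ⟨u, hu, rfl⟩ := D.bijOn_logTeich.surjOn hb
    exact ⟨u, hu, rfl⟩
  · rintro ⟨u, hu, rfl⟩
    exact ⟨D.logTeich u, D.bijOn_logTeich.mapsTo hu, rfl⟩

/-- Thm. 9.3.1.1 (2) rephrased over the typed `B^{φ=p}`: `B = ℚ_p[B^{φ=p}]`. [claim: Joshi2024ATS3, status: disputed] -/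
theorem adjoin_Bphi_eq : Algebra.adjoin ℚ_[p] (D.Bphi : Set Bt) = D.B := D.adjoin_Bphi

/-- DERIVED: `B^{φ=p} ⊆ B` and `I_{joshi,p} ⊆ B[1/t]` is generated over `B^{φ=p}` by the single element `t⁻¹`: every element of
`I_{joshi,p}` is `t⁻¹·b`, `b ∈ B`. [claim: Joshi2024ATS3, status: disputed] -/
theorem exists_mem_B_of_mem_joshiLogShell {x : Bt} (hx : x ∈ D.joshiLogShell) : ∃ b ∈ D.B, x = ((D.t⁻¹ : Btˣ) : Bt) * b := by
  obtain ⟨b, hb, rfl⟩ := (D.mem_joshiLogShell_iff x).1 hx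
  exact ⟨b, hb.1, rfl⟩

end PeriodRingBt

end Summit.ABC.IUTFork.Joshi

end
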